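import Mathlib
import HarnessLib
import Summits.Ventures.LatticeQCDFlow.Exactness.NCMCGeneralSpaceReplicaTStatistic
import Summits.Ventures.LatticeQCDFlow.Exactness.NCMCGeneralSpaceReplicaTStatisticCoverage

/-!
# The limit law of the replica `t`-statistic IS Student's ratio: a standard normal over the root mean square of `R − 1` INDEPENDENT standard normals (Helmert's reflection)

HONEST FRAMING: exact (Metropolis-corrected) sampling algorithms for lattice gauge theory;
figures of merit are autocorrelation/cost numbers at stated couplings and volumes; no
continuum-physics claim.

Venture `LatticeQCDFlow` (cell pub-lqcd), topic `Exactness`; FANOUT row 13 (`eng-snf`, GEN-24).  NEW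
WORK of the cell against Mathlib (`stdGaussian`, `stdGaussian_map` — invariance of the standard
Gaussian of a finite-dimensional inner product space under linear isometries —, `map_pi_eq_stdGaussian`,
`Submodule.reflection_sub`) and the tree's GEN-23 files `NCMCGeneralSpaceReplicaTStatistic` (K:
`measurable_tStat`) / `NCMCGeneralSpaceReplicaTStatisticCoverage` (K3: `measurable_tStat_pi`,
`sumSqDev_eq_sum_sq_sub`, `pi_gaussianReal_measure_abs_tStat_le_eq`); not a published result; no
definition is introduced; nothing is cited as a fact (Helmert 1876 / Student 1908 / Fisher 1925 NAMED
ONLY).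

WHY (row 13).  GEN-23 proved that the engine's replica-jackknife / `target_means` / "independent runs"
error bar read with a quantile `q` has ONE limiting coverage `L_R(q) = N(0,1)^{⊗R}{z | |t(z)| ≤ q}`,
`t(z) = z̄ / √(Σ_r (z_r − z̄)²/(R(R−1)))`, for every chain, observable and start family (K3/K4/I), with
an existing, unique calibrating quantile (K5/K6) — and left the VALUE of `L_R` untyped.  This file
identifies the limit law structurally: under `N(0,1)^{⊗R}`, `t` has THE SAME LAW as
`z_{r₀} / √((Σ_{r ≠ r₀} z_r²)/(R − 1))` — a standard normal over the root mean square of `R − 1`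
further INDEPENDENT standard normals, i.e. Student's ratio with `R − 1` degrees of freedom (Fisher's
form), so the calibrating quantile is the textbook Student quantile.  Proof (Helmert): the reflection
`O` of `EuclideanSpace ℝ ι` exchanging the unit diagonal `u = (√R)⁻¹ 𝟙` with `e_{r₀}` is a linear
isometry, hence preserves the standard Gaussian (`stdGaussian_map`), and `t = h ∘ O` with
`h(w) = w_{r₀} / √((‖w‖² − w_{r₀}²)/(R−1))` since `⟨O z, e_{r₀}⟩ = ⟨z, u⟩ = √R z̄`, `‖O z‖ = ‖z‖`.

## Content
* `norm_toLp_const_invSqrt`, `inner_toLp_const_invSqrt` (§1) — the unit diagonal `u`: `‖u‖ = 1`,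
  `⟨x, u⟩ = (Σ_r x_r)/√R`.
* `helmertReflection_apply_diag` / `_coord` (§1) — `O u = e_{r₀}`, `(O x)_{r₀} = (Σ_r x_r)/√R`;
  `sum_sq_erase_helmertReflection_eq_sumSqDev` (§2) — `Σ_{r ≠ r₀} (O x)_r² = Σ_r (x_r − x̄)²`.
* **`tStat_eq_studentRatio_helmertReflection`** (§2) — `t(x) = h(O x)` for every `x`.
* **`pi_gaussianReal_map_tStat_eq_map_studentRatio`** (§3) — the laws of `t` and of
  `z ↦ z_{r₀}/√((Σ_{r ≠ r₀} z_r²)/(R−1))` under `N(0,1)^{⊗R}` coincide (`R ≥ 2`).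
* **`pi_gaussianReal_measure_abs_tStat_le_eq_studentRatio`** (§3) — for every `q` and every `v ≠ 0`:
  `N(0,v)^{⊗R}{|t| ≤ q} = N(0,1)^{⊗R}{z | |z_{r₀}| ≤ q √((Σ_{r ≠ r₀} z_r²)/(R−1))}` — the limiting
  coverage `L_R(q)` of GEN-23 K3/K4/I is the two-sided Student-ratio probability.
* `indepFun_eval_sumSq_erase_pi` (§3) — under the product law the numerator `z_{r₀}` and
  `Σ_{r ≠ r₀} z_r²` are independent (the "ratio of INDEPENDENT normal and root-mean-χ²" reading);
  **`indepFun_mean_sumSqDev_pi_gaussianReal`** — under `N(0,1)^{⊗R}` the sample mean and the sum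
  of squared deviations are independent (the Gaussian half of Geary's characterisation).

NOT CLAIMED: the density of Student's law / the name `t_{R−1}` as a Mathlib object (Mathlib has no
Student or χ² distribution at this date; the statement above is the definition-level identification);
numerical quantiles; anything about chains beyond what K4/K7 already state (combine them with §3).
-/

namespace Summit.Ventures.LatticeQCDFlow.Exactness.GeneralNCMC

open MeasureTheory ProbabilityTheory Set Filter Topology Finset WithLp
open scoped ENNReal NNReal Topology RealInnerProductSpace

/-! ## §1 Helmert's reflection: the unit diagonal goes to a basis vector -/

section Helmert

variable {ι : Type*} [Fintype ι] [DecidableEq ι]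

omit [DecidableEq ι] in
/-- The unit diagonal `u = (√R)⁻¹ 𝟙` has norm one (`R = card ι ≥ 1`). -/
theorem norm_toLp_const_invSqrt [Nonempty ι] :
    ‖(toLp 2 (fun _ : ι => (Real.sqrt (Fintype.card ι))⁻¹) : EuclideanSpace ℝ ι)‖ = 1 := by
  have hR : (0 : ℝ) < Fintype.card ι := by exact_mod_cast Fintype.card_pos
  rw [EuclideanSpace.norm_eq]
  simp only [Real.norm_eq_abs, sq_abs, inv_pow, Real.sq_sqrt hR.le, sum_const, card_univ,
    nsmul_eq_mul]
  rw [mul_inv_cancel₀ hR.ne', Real.sqrt_one]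

omit [DecidableEq ι] in
/-- `⟨x, u⟩ = (Σ_r x_r) / √R`. -/
theorem inner_toLp_const_invSqrt (x : EuclideanSpace ℝ ι) :
    ⟪x, (toLp 2 (fun _ : ι => (Real.sqrt (Fintype.card ι))⁻¹) : EuclideanSpace ℝ ι)⟫
      = (∑ r, x r) / Real.sqrt (Fintype.card ι) := by
  rw [PiLp.inner_apply]
  simp only [RCLike.inner_apply, conj_trivial]
  rw [div_eq_mul_inv, sum_mul]
  exact sum_congr rfl fun r _ => mul_comm _ _

/-- **Helmert's reflection maps the unit diagonal to the basis vector `e_{r₀}`**: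
`O u = e_{r₀}` for `O` the reflection in the hyperplane `(ℝ ∙ (u − e_{r₀}))ᗮ`. -/
theorem helmertReflection_apply_diag [Nonempty ι] (r₀ : ι) :
    ((ℝ ∙ ((toLp 2 (fun _ : ι => (Real.sqrt (Fintype.card ι))⁻¹) : EuclideanSpace ℝ ι)
        - EuclideanSpace.single r₀ (1 : ℝ)))ᗮ).reflection
        (toLp 2 (fun _ : ι => (Real.sqrt (Fintype.card ι))⁻¹))
      = EuclideanSpace.single r₀ (1 : ℝ) := by
  apply Submodule.reflection_sub
  rw [norm_toLp_const_invSqrt, PiLp.norm_single, norm_one]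

/-- **The `r₀`-th coordinate after Helmert's reflection is `√R` times the mean**:
`(O x)_{r₀} = ⟨O x, e_{r₀}⟩ = ⟨O x, O u⟩ = ⟨x, u⟩ = (Σ_r x_r)/√R`. -/
theorem helmertReflection_coord [Nonempty ι] (r₀ : ι) (x : EuclideanSpace ℝ ι) :
    ((ℝ ∙ ((toLp 2 (fun _ : ι => (Real.sqrt (Fintype.card ι))⁻¹) : EuclideanSpace ℝ ι)
        - EuclideanSpace.single r₀ (1 : ℝ)))ᗮ).reflection x r₀
      = (∑ r, x r) / Real.sqrt (Fintype.card ι) := by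
  set O := ((ℝ ∙ ((toLp 2 (fun _ : ι => (Real.sqrt (Fintype.card ι))⁻¹) : EuclideanSpace ℝ ι)
        - EuclideanSpace.single r₀ (1 : ℝ)))ᗮ).reflection with hO
  have h1 : O x r₀ = ⟪O x, EuclideanSpace.single r₀ (1 : ℝ)⟫ := by
    rw [EuclideanSpace.inner_single_right]
    simp
  rw [h1, ← helmertReflection_apply_diag r₀, ← hO, LinearIsometryEquiv.inner_map_map,
    inner_toLp_const_invSqrt]

/-- `Σ_{r ≠ r₀} w_r² = ‖w‖² − w_{r₀}²` on `EuclideanSpace ℝ ι`. -/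
theorem sum_sq_erase_eq_norm_sq_sub (r₀ : ι) (w : EuclideanSpace ℝ ι) :
    ∑ r ∈ univ.erase r₀, w r ^ 2 = ‖w‖ ^ 2 - w r₀ ^ 2 := by
  rw [EuclideanSpace.real_norm_sq_eq, ← Finset.sum_erase_add _ _ (mem_univ r₀)]
  ring

end Helmert

/-! ## §2 `t = h ∘ O`: the `t`-statistic is Student's ratio of the reflected coordinates -/

section Identity

variable {ι : Type*} [Fintype ι] [DecidableEq ι]

/-- `√(D/(R(R−1))) = √(D/(R−1)) / √R`. -/
theorem sqrt_div_mul_eq (D R : ℝ) (hR : 0 ≤ R) :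
    Real.sqrt (D / (R * (R - 1))) = Real.sqrt (D / (R - 1)) / Real.sqrt R := by
  rw [mul_comm, ← div_div, Real.sqrt_div' _ hR]

/-- **The other reflected coordinates carry the sum of squared deviations**:
`Σ_{r ≠ r₀} (O x)_r² = ‖O x‖² − (O x)_{r₀}² = ‖x‖² − R x̄² = Σ_r (x_r − x̄)²`. -/
theorem sum_sq_erase_helmertReflection_eq_sumSqDev [Nonempty ι] (r₀ : ι) (x : EuclideanSpace ℝ ι) :
    ∑ r ∈ univ.erase r₀,
        (((ℝ ∙ ((toLp 2 (fun _ : ι => (Real.sqrt (Fintype.card ι))⁻¹) : EuclideanSpace ℝ ι)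
          - EuclideanSpace.single r₀ (1 : ℝ)))ᗮ).reflection x) r ^ 2
      = ∑ r, (x r - (∑ r', x r') / (Fintype.card ι : ℝ)) ^ 2 := by
  set O := ((ℝ ∙ ((toLp 2 (fun _ : ι => (Real.sqrt (Fintype.card ι))⁻¹) : EuclideanSpace ℝ ι)
        - EuclideanSpace.single r₀ (1 : ℝ)))ᗮ).reflection with hO
  have hR : (0 : ℝ) < Fintype.card ι := by exact_mod_cast Fintype.card_pos
  rw [sum_sq_erase_eq_norm_sq_sub, hO, helmertReflection_coord, ← hO, LinearIsometryEquiv.norm_map,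
    sumSqDev_eq_sum_sq_sub, EuclideanSpace.real_norm_sq_eq, div_pow, Real.sq_sqrt hR.le]

/-- **`t(x) = h(O x)`** for EVERY `x`: with `O` Helmert's reflection and
`h(w) = w_{r₀} / √((Σ_{r ≠ r₀} w_r²)/(R − 1))`,
`x̄ / √(Σ_r (x_r − x̄)²/(R(R−1))) = h(O x)` (both sides are `0` on the diagonal, where the
denominators vanish — Lean's `x / 0 = 0`). -/
theorem tStat_eq_studentRatio_helmertReflection [Nonempty ι] (r₀ : ι) (x : EuclideanSpace ℝ ι) :
    (∑ r, x r) / Fintype.card ι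
        / Real.sqrt ((∑ r, (x r - (∑ r', x r') / Fintype.card ι) ^ 2)
            / ((Fintype.card ι : ℝ) * (Fintype.card ι - 1)))
      = (((ℝ ∙ ((toLp 2 (fun _ : ι => (Real.sqrt (Fintype.card ι))⁻¹) : EuclideanSpace ℝ ι)
            - EuclideanSpace.single r₀ (1 : ℝ)))ᗮ).reflection x) r₀
        / Real.sqrt ((∑ r ∈ univ.erase r₀,
            (((ℝ ∙ ((toLp 2 (fun _ : ι => (Real.sqrt (Fintype.card ι))⁻¹) : EuclideanSpace ℝ ι)
              - EuclideanSpace.single r₀ (1 : ℝ)))ᗮ).reflection x) r ^ 2)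
            / ((Fintype.card ι : ℝ) - 1)) := by
  have hR : (0 : ℝ) < Fintype.card ι := by exact_mod_cast Fintype.card_pos
  have hsq : Real.sqrt (Fintype.card ι : ℝ) ≠ 0 := (Real.sqrt_pos.2 hR).ne'
  rw [sum_sq_erase_helmertReflection_eq_sumSqDev, helmertReflection_coord,
    sqrt_div_mul_eq _ _ hR.le]
  set S := ∑ r, x r
  set T := Real.sqrt ((∑ r, (x r - (∑ r', x r') / (Fintype.card ι : ℝ)) ^ 2)
    / ((Fintype.card ι : ℝ) - 1))
  by_cases hT : T = 0
  · simp [hT]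
  · field_simp
    rw [Real.sq_sqrt hR.le]

end Identity

/-! ## §3 The laws coincide: `t(Z) ~ Z_{r₀} / √((Σ_{r ≠ r₀} Z_r²)/(R−1))`, `Z ~ N(0,1)^{⊗R}` -/

section Law

variable {ι : Type*} [Fintype ι] [DecidableEq ι]

/-- Student's ratio `z ↦ z_{r₀}/√((Σ_{r ≠ r₀} z_r²)/(R−1))` is Borel measurable on `ι → ℝ`. -/
theorem measurable_studentRatio_pi (r₀ : ι) :
    Measurable fun z : ι → ℝ =>
      z r₀ / Real.sqrt ((∑ r ∈ univ.erase r₀, z r ^ 2) / ((Fintype.card ι : ℝ) - 1)) := by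
  have hc : ∀ r : ι, Measurable fun z : ι → ℝ => z r := fun r => measurable_pi_apply r
  have hden : Continuous fun z : ι → ℝ =>
      Real.sqrt ((∑ r ∈ univ.erase r₀, z r ^ 2) / ((Fintype.card ι : ℝ) - 1)) := by
    fun_prop
  exact (hc r₀).div hden.measurable

/-- Student's ratio is Borel measurable on `EuclideanSpace ℝ ι`. -/
theorem measurable_studentRatio (r₀ : ι) :
    Measurable fun w : EuclideanSpace ℝ ι =>
      w r₀ / Real.sqrt ((∑ r ∈ univ.erase r₀, w r ^ 2) / ((Fintype.card ι : ℝ) - 1)) := by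
  have hc : ∀ r : ι, Continuous fun w : EuclideanSpace ℝ ι => w r := fun r =>
    PiLp.continuous_apply 2 _ r
  have hden : Continuous fun w : EuclideanSpace ℝ ι =>
      Real.sqrt ((∑ r ∈ univ.erase r₀, w r ^ 2) / ((Fintype.card ι : ℝ) - 1)) := by
    fun_prop
  exact (hc r₀).measurable.div hden.measurable

/-- **THE LIMIT LAW OF THE REPLICA `t`-STATISTIC IS STUDENT'S RATIO LAW WITH `R − 1` DEGREES OF
FREEDOM** (Helmert): under `N(0,1)^{⊗R}`, `R = card ι ≥ 1`, for any coordinate `r₀`, the law of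
`t(z) = z̄/√(Σ_r (z_r − z̄)²/(R(R−1)))` equals the law of `z_{r₀}/√((Σ_{r ≠ r₀} z_r²)/(R−1))` — a
standard normal over the root mean square of the `R − 1` remaining (independent, standard normal)
coordinates. -/
theorem pi_gaussianReal_map_tStat_eq_map_studentRatio [Nonempty ι] (r₀ : ι) :
    (Measure.pi fun _ : ι => gaussianReal 0 1).map (fun z : ι → ℝ =>
        (∑ r, z r) / Fintype.card ι
          / Real.sqrt ((∑ r, (z r - (∑ r', z r') / Fintype.card ι) ^ 2)
              / ((Fintype.card ι : ℝ) * (Fintype.card ι - 1))))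
      = (Measure.pi fun _ : ι => gaussianReal 0 1).map (fun z : ι → ℝ =>
        z r₀ / Real.sqrt ((∑ r ∈ univ.erase r₀, z r ^ 2) / ((Fintype.card ι : ℝ) - 1))) := by
  set O := ((ℝ ∙ ((toLp 2 (fun _ : ι => (Real.sqrt (Fintype.card ι))⁻¹) : EuclideanSpace ℝ ι)
        - EuclideanSpace.single r₀ (1 : ℝ)))ᗮ).reflection with hO
  -- the two statistics read through `toLp 2`
  have ht : (fun z : ι → ℝ => (∑ r, z r) / Fintype.card ι
          / Real.sqrt ((∑ r, (z r - (∑ r', z r') / Fintype.card ι) ^ 2)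
              / ((Fintype.card ι : ℝ) * (Fintype.card ι - 1))))
      = (fun x : EuclideanSpace ℝ ι => (∑ r, x r) / Fintype.card ι
          / Real.sqrt ((∑ r, (x r - (∑ r', x r') / Fintype.card ι) ^ 2)
              / ((Fintype.card ι : ℝ) * (Fintype.card ι - 1)))) ∘ (toLp 2) := rfl
  have hh : (fun z : ι → ℝ =>
        z r₀ / Real.sqrt ((∑ r ∈ univ.erase r₀, z r ^ 2) / ((Fintype.card ι : ℝ) - 1)))
      = (fun w : EuclideanSpace ℝ ι =>
        w r₀ / Real.sqrt ((∑ r ∈ univ.erase r₀, w r ^ 2) / ((Fintype.card ι : ℝ) - 1)))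
          ∘ (toLp 2) := rfl
  -- `t = h ∘ O` on `EuclideanSpace ℝ ι`
  have htO : (fun x : EuclideanSpace ℝ ι => (∑ r, x r) / Fintype.card ι
          / Real.sqrt ((∑ r, (x r - (∑ r', x r') / Fintype.card ι) ^ 2)
              / ((Fintype.card ι : ℝ) * (Fintype.card ι - 1))))
      = (fun w : EuclideanSpace ℝ ι =>
          w r₀ / Real.sqrt ((∑ r ∈ univ.erase r₀, w r ^ 2) / ((Fintype.card ι : ℝ) - 1))) ∘ O := by
    funext x
    rw [Function.comp_apply, hO]
    exact tStat_eq_studentRatio_helmertReflection r₀ x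
  have hmeas_toLp : Measurable (toLp 2 : (ι → ℝ) → EuclideanSpace ℝ ι) :=
    (PiLp.continuous_toLp 2 _).measurable
  rw [ht, hh, ← Measure.map_map measurable_tStat hmeas_toLp,
    ← Measure.map_map (measurable_studentRatio r₀) hmeas_toLp, map_pi_eq_stdGaussian, htO,
    ← Measure.map_map (measurable_studentRatio r₀) O.continuous.measurable, stdGaussian_map O]

/-- Set form:
**`N(0,1)^{⊗R}{|t| ≤ q} = N(0,1)^{⊗R}{z | |z_{r₀}/√((Σ_{r ≠ r₀} z_r²)/(R−1))| ≤ q}`**. -/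
theorem pi_gaussianReal_measure_abs_tStat_le_eq_studentRatio_one [Nonempty ι] (r₀ : ι) (q : ℝ) :
    (Measure.pi fun _ : ι => gaussianReal 0 1) {z : ι → ℝ | |(∑ r, z r) / Fintype.card ι
        / Real.sqrt ((∑ r, (z r - (∑ r', z r') / Fintype.card ι) ^ 2)
            / ((Fintype.card ι : ℝ) * (Fintype.card ι - 1)))| ≤ q}
      = (Measure.pi fun _ : ι => gaussianReal 0 1) {z : ι → ℝ |
        |z r₀ / Real.sqrt ((∑ r ∈ univ.erase r₀, z r ^ 2) / ((Fintype.card ι : ℝ) - 1))| ≤ q} := by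
  have hS : MeasurableSet {y : ℝ | |y| ≤ q} := measurableSet_le measurable_id.abs measurable_const
  have h1 := congrArg (fun ν : Measure ℝ => ν {y : ℝ | |y| ≤ q})
    (pi_gaussianReal_map_tStat_eq_map_studentRatio (ι := ι) r₀)
  simp only at h1
  rw [Measure.map_apply measurable_tStat_pi hS,
    Measure.map_apply (measurable_studentRatio_pi r₀) hS] at h1
  exact h1

/-- **THE LIMITING COVERAGE `L_R(q)` OF THE REPLICA-`t` / INDEPENDENT-RUNS BAR IS THE TWO-SIDED
STUDENT-RATIO PROBABILITY**: for every `v ≠ 0`, every `q` and `R ≥ 2`,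
`N(0,v)^{⊗R}{|t| ≤ q} = N(0,1)^{⊗R}{z | |z_{r₀}| ≤ q · √((Σ_{r ≠ r₀} z_r²)/(R−1))}` — the
probability that a standard normal lies within `q` root-mean-squares of `R − 1` further independent
standard normals (textbook: `P(|t_{R−1}| ≤ q)`; the name is not a Mathlib object).  Combine with
GEN-23/24 `tendsto_measure_abs_replicaTStat_le_of_nHit` (chains from any starts) or
`tendsto_measure_abs_studentised_le_of_indep` (independent runs of any estimator). -/
theorem pi_gaussianReal_measure_abs_tStat_le_eq_studentRatio [Nontrivial ι] (r₀ : ι) {v : ℝ≥0}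
    (hv : v ≠ 0) (q : ℝ) :
    (Measure.pi fun _ : ι => gaussianReal 0 v) {z : ι → ℝ | |(∑ r, z r) / Fintype.card ι
        / Real.sqrt ((∑ r, (z r - (∑ r', z r') / Fintype.card ι) ^ 2)
            / ((Fintype.card ι : ℝ) * (Fintype.card ι - 1)))| ≤ q}
      = (Measure.pi fun _ : ι => gaussianReal 0 1) {z : ι → ℝ |
        |z r₀| ≤ q * Real.sqrt ((∑ r ∈ univ.erase r₀, z r ^ 2) / ((Fintype.card ι : ℝ) - 1))} := by
  rw [pi_gaussianReal_measure_abs_tStat_le_eq hv q,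
    pi_gaussianReal_measure_abs_tStat_le_eq_studentRatio_one r₀ q]
  obtain ⟨r₁, hr₁⟩ := exists_ne r₀
  have hR1 : (0 : ℝ) < (Fintype.card ι : ℝ) - 1 := by
    have h := Fintype.one_lt_card (α := ι)
    have h' : (1 : ℝ) < Fintype.card ι := by exact_mod_cast h
    linarith
  -- off the null hyperplane `{z_{r₁} = 0}` the two events coincide
  have hnull : (Measure.pi fun _ : ι => gaussianReal 0 1) {z : ι → ℝ | z r₁ = 0} = 0 := by
    have : NullSingletonClass (gaussianReal (0 : ℝ) (1 : ℝ≥0)) :=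
      nullSingletonClass_gaussianReal one_ne_zero
    exact Measure.pi_hyperplane _ r₁ 0
  refine measure_congr ?_
  have hae : ∀ᵐ z ∂(Measure.pi fun _ : ι => gaussianReal 0 1), z r₁ ≠ 0 := by
    rw [ae_iff]
    simpa only [not_not] using hnull
  filter_upwards [hae] with z hz
  have hD : 0 < Real.sqrt ((∑ r ∈ univ.erase r₀, z r ^ 2) / ((Fintype.card ι : ℝ) - 1)) := by
    refine Real.sqrt_pos.2 (div_pos ?_ hR1)
    refine lt_of_lt_of_le (by positivity : (0 : ℝ) < z r₁ ^ 2) ?_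
    exact Finset.single_le_sum (f := fun r => z r ^ 2) (fun r _ => sq_nonneg (z r))
      (Finset.mem_erase.2 ⟨hr₁, mem_univ r₁⟩)
  simp only [eq_iff_iff]
  change |z r₀ / _| ≤ q ↔ |z r₀| ≤ q * _
  rw [abs_div, abs_of_pos hD, div_le_iff₀ hD]

/-- **The "ratio of INDEPENDENT quantities" reading**: under any product of probability laws on
`ℝ`, the numerator coordinate `z_{r₀}` and the sum of squares of the other coordinates
`Σ_{r ≠ r₀} z_r²` are independent (so, under `N(0,1)^{⊗R}`, Student's ratio above is a standard
normal over the root mean of `R − 1` squared standard normals INDEPENDENT of it). -/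
theorem indepFun_eval_sumSq_erase_pi {μ : ι → Measure ℝ} [∀ i, IsProbabilityMeasure (μ i)]
    (r₀ : ι) :
    IndepFun (fun z : ι → ℝ => z r₀) (fun z : ι → ℝ => ∑ r ∈ univ.erase r₀, z r ^ 2)
      (Measure.pi μ) := by
  set X : ι → ℝ → ℝ := fun j y => if j = r₀ then y else y ^ 2 with hX
  have hXm : ∀ j, Measurable (X j) := by
    intro j
    by_cases hj : j = r₀
    · simp only [hX, hj, if_true]
      exact measurable_id
    · simp only [hX, hj, if_false]
      exact measurable_id.pow_const 2
  have hind : iIndepFun (fun j (z : ι → ℝ) => X j (z j)) (Measure.pi μ) :=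
    iIndepFun_pi fun j => (hXm j).aemeasurable
  have h := hind.indepFun_finsetSum_of_notMem (fun j => (hXm j).comp (measurable_pi_apply j))
    (Finset.notMem_erase r₀ univ)
  have h1 : (∑ j ∈ univ.erase r₀, fun z : ι → ℝ => X j (z j))
      = fun z : ι → ℝ => ∑ r ∈ univ.erase r₀, z r ^ 2 := by
    funext z
    rw [Finset.sum_apply]
    refine sum_congr rfl fun j hj => ?_
    simp only [hX, ne_of_mem_erase hj, if_false]
  have h2 : (fun z : ι → ℝ => X r₀ (z r₀)) = fun z : ι → ℝ => z r₀ := by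
    funext z
    simp only [hX, if_true]
  rw [h1, h2] at h
  exact h.symm

/-- Transfer of independence along two maps with the same law: if `μ ∘ F⁻¹ = μ ∘ G⁻¹` and
`f ∘ G`, `g ∘ G` are independent under `μ`, so are `f ∘ F`, `g ∘ F`. -/
theorem indepFun_comp_of_map_eq_map {Ω : Type*} [MeasurableSpace Ω] {μ : Measure Ω}
    [IsProbabilityMeasure μ] {E : Type*} [MeasurableSpace E] {β : Type*} [MeasurableSpace β]
    {β' : Type*} [MeasurableSpace β'] {F G : Ω → E} (hF : Measurable F) (hG : Measurable G)
    (hFG : μ.map F = μ.map G) {f : E → β} {g : E → β'} (hf : Measurable f) (hg : Measurable g)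
    (h : IndepFun (f ∘ G) (g ∘ G) μ) : IndepFun (f ∘ F) (g ∘ F) μ := by
  rw [indepFun_iff_map_prod_eq_prod_map_map ((hf.comp hG).aemeasurable)
    ((hg.comp hG).aemeasurable)] at h
  rw [indepFun_iff_map_prod_eq_prod_map_map ((hf.comp hF).aemeasurable)
    ((hg.comp hF).aemeasurable)]
  have e1 : μ.map (fun ω => ((f ∘ F) ω, (g ∘ F) ω)) = (μ.map F).map (fun x => (f x, g x)) := by
    rw [Measure.map_map (hf.prodMk hg) hF]
    rfl
  have e2 : μ.map (fun ω => ((f ∘ G) ω, (g ∘ G) ω)) = (μ.map G).map (fun x => (f x, g x)) := by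
    rw [Measure.map_map (hf.prodMk hg) hG]
    rfl
  rw [e1, hFG, ← e2, h, ← Measure.map_map hf hG, ← Measure.map_map hg hG, ← hFG,
    Measure.map_map hf hF, Measure.map_map hg hF]

/-- **SAMPLE MEAN AND SUM OF SQUARED DEVIATIONS ARE INDEPENDENT UNDER `N(0,1)^{⊗R}`** (the Gaussian
half of Geary's characterisation; Helmert again): `z̄ = (O z)_{r₀}/√R` and
`Σ_r (z_r − z̄)² = Σ_{r ≠ r₀} (O z)_r²` are functions of disjoint sets of the reflected coordinates,
and `O z ~ N(0,1)^{⊗R}`. -/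
theorem indepFun_mean_sumSqDev_pi_gaussianReal [Nonempty ι] :
    IndepFun (fun z : ι → ℝ => (∑ r, z r) / Fintype.card ι)
      (fun z : ι → ℝ => ∑ r, (z r - (∑ r', z r') / Fintype.card ι) ^ 2)
      (Measure.pi fun _ : ι => gaussianReal 0 1) := by
  obtain ⟨r₀⟩ := ‹Nonempty ι›
  set O := ((ℝ ∙ ((toLp 2 (fun _ : ι => (Real.sqrt (Fintype.card ι))⁻¹) : EuclideanSpace ℝ ι)
        - EuclideanSpace.single r₀ (1 : ℝ)))ᗮ).reflection with hO
  set μ : Measure (ι → ℝ) := Measure.pi fun _ : ι => gaussianReal 0 1 with hμ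
  have hR : (0 : ℝ) < Fintype.card ι := by exact_mod_cast Fintype.card_pos
  have hmeas_toLp : Measurable (toLp 2 : (ι → ℝ) → EuclideanSpace ℝ ι) :=
    (PiLp.continuous_toLp 2 _).measurable
  have hF : Measurable (fun z : ι → ℝ => O (toLp 2 z)) := O.continuous.measurable.comp hmeas_toLp
  -- `O ∘ toLp` and `toLp` push `N(0,1)^{⊗R}` to the same law (the standard Gaussian of `E`)
  have hFG : μ.map (fun z : ι → ℝ => O (toLp 2 z)) = μ.map (toLp 2) := by
    have hcomp : (fun z : ι → ℝ => O (toLp 2 z)) = ⇑O ∘ (toLp 2) := rfl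
    rw [hcomp, ← Measure.map_map O.continuous.measurable hmeas_toLp, hμ, map_pi_eq_stdGaussian,
      stdGaussian_map O]
  have hc : ∀ r : ι, Measurable fun w : EuclideanSpace ℝ ι => w r := fun r =>
    (PiLp.continuous_apply 2 _ r).measurable
  have hf : Measurable fun w : EuclideanSpace ℝ ι => w r₀ / Real.sqrt (Fintype.card ι) :=
    (hc r₀).div_const _
  have hg : Measurable fun w : EuclideanSpace ℝ ι => ∑ r ∈ univ.erase r₀, w r ^ 2 := by
    fun_prop
  -- under `toLp`: the coordinate `z_{r₀}/√R` and `Σ_{r ≠ r₀} z_r²` are independent (product law)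
  have hG : IndepFun ((fun w : EuclideanSpace ℝ ι => w r₀ / Real.sqrt (Fintype.card ι)) ∘ (toLp 2))
      ((fun w : EuclideanSpace ℝ ι => ∑ r ∈ univ.erase r₀, w r ^ 2) ∘ (toLp 2)) μ := by
    have h0 := (indepFun_eval_sumSq_erase_pi (μ := fun _ : ι => gaussianReal 0 1) r₀).comp
      (measurable_id.div_const (Real.sqrt (Fintype.card ι))) measurable_id
    exact h0
  have h := indepFun_comp_of_map_eq_map hF hmeas_toLp hFG hf hg hG
  -- read the two compositions with `O ∘ toLp` as the mean and the sum of squared deviations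
  have e1 : (fun w : EuclideanSpace ℝ ι => w r₀ / Real.sqrt (Fintype.card ι))
      ∘ (fun z : ι → ℝ => O (toLp 2 z)) = fun z : ι → ℝ => (∑ r, z r) / Fintype.card ι := by
    funext z
    rw [Function.comp_apply, hO, helmertReflection_coord, div_div, Real.mul_self_sqrt hR.le]
  have e2 : (fun w : EuclideanSpace ℝ ι => ∑ r ∈ univ.erase r₀, w r ^ 2)
      ∘ (fun z : ι → ℝ => O (toLp 2 z))
        = fun z : ι → ℝ => ∑ r, (z r - (∑ r', z r') / Fintype.card ι) ^ 2 := by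
    funext z
    rw [Function.comp_apply, hO, sum_sq_erase_helmertReflection_eq_sumSqDev]
  rw [e1, e2] at h
  exact h

end Law

end Summit.Ventures.LatticeQCDFlow.Exactness.GeneralNCMC
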